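import Literature.Analysis.UnboundedOperators.SpectralGapProofs
import HarnessLib

/-!
# The spectral form of the transfer-matrix gap (companion of `SpectralGap.lean`)

Discharge of the named fact `ContinuousLinearMap.hasTransferGap_iff_spectrum` stated in
`Literature/Analysis/UnboundedOperators/SpectralGap.lean`: for a bounded operator `T` on a Hilbert
space over `RCLike 𝕜`, a vector `Ω` and `m : ℝ`,

`T.HasTransferGap Ω m` (`T ≥ 0`, `Ω ≠ 0`, `T Ω = Ω`, `0 < m`, `re ⟪T x, x⟫ ≤ e^{-m} ‖x‖²` on `{Ω}ᗮ`)
`↔ IsSelfAdjoint T ∧ Ω ≠ 0 ∧ 0 < m ∧ re σ(T) ⊆ [0, e^{-m}] ∪ {1} ∧ eigenspace T 1 = 𝕜 ∙ Ω`.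

This is the transfer-matrix (`T = e^{-H}`) reading of "unique vacuum and mass gap `m`"
(Glimm–Jaffe, *Quantum Physics*, §6.1, Theorem 6.1.3 ff.) and, mathematically, an instance of the
spectral theorem for bounded self-adjoint operators (Reed–Simon I, Theorem VI.8: `σ(T) ⊆ ℝ` via
`‖(T - λ - iμ) x‖ ≥ |μ| ‖x‖`; §VII.3, Proposition after Theorem VII.8 and Theorem VII.10:
`λ ∈ σ(T)` iff the spectral projection of every neighbourhood of `λ` is non-zero, so that an
isolated point of `σ(T)` is an eigenvalue and `inf / sup σ(T)` bound the quadratic form).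

Mathlib has the continuous functional calculus for `E →L[𝕜] E` only when `𝕜 = ℂ`
(`ContinuousLinearMap.instStarOrderedRingRCLike`), so — exactly as for the neighbouring discharge
`ContinuousLinearMap.hasGroundStateGap_toPMap_iff_holds` — the printed spectral-measure arguments
are replaced by the elementary numerical-range / resolvent lemmas of `SpectralGapProofs.lean`,
uniformly in `𝕜 = ℝ, ℂ`:

* (⇒) `1` is a simple eigenvalue with eigenvector `Ω` because the gap `e^{-m} < 1` kills the
  component in `{Ω}ᗮ` of any fixed vector; and for `μ` with `re μ ∉ [0, e^{-m}] ∪ {1}` the operator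
  `T - μ` is invertible: by coercivity (`ContinuousLinearMap.isUnit_of_forall_le_norm_inner_map`)
  when `im μ ≠ 0` (Reed–Simon I, proof of Thm VI.8), when `re μ < 0` (`T ≥ 0`) and when `re μ > 1`
  (`T ≤ 1`, `re_inner_le_norm_sq_of_orthogonal_bound`), and because it is bounded below by
  `min (1 - re μ) (re μ - e^{-m})` on `E = 𝕜Ω ⊕ {Ω}ᗮ` when `e^{-m} < re μ < 1`
  (`ContinuousLinearMap.isUnit_of_isSelfAdjoint_of_forall_le_norm`).
* (⇐) real points off `[0, e^{-m}] ∪ {1}` are in the resolvent set, so `0 ≤ T ≤ 1` in the form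
  sense (`ContinuousLinearMap.re_inner_ge_of_forall_lt_isUnit`, `re_inner_le_of_forall_gt_isUnit`);
  then `T' := 1 - T ≥ 0` has `T' - ν` invertible for `ν ∈ (0, 1 - e^{-m})`, hence
  `T' ≥ 1 - e^{-m}` on `range T'` (`ContinuousLinearMap.gap_le_re_inner_on_range`) and on its
  closure `(ker T')ᗮ = (eigenspace T 1)ᗮ = {Ω}ᗮ` (`ContinuousLinearMap.orthogonal_ker`), which is
  `re ⟪T x, x⟫ ≤ e^{-m} ‖x‖²` on `{Ω}ᗮ`.

References: M. Reed, B. Simon, *Methods of Modern Mathematical Physics I: Functional Analysis*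
(rev. ed. 1980), Thm VI.8 and §VII.3 (Thm VII.10) [ReedSimonI1980]; J. Glimm, A. Jaffe,
*Quantum Physics* (2nd ed. 1987), §6.1, Thm 6.1.3 ff. [GlimmJaffeQP1987].

Mathlib anchors: `Submodule.exists_add_mem_mem_orthogonal`, `Module.End.mem_eigenspace_iff`,
`ContinuousLinearMap.isUnit_of_forall_le_norm_inner_map`, `ContinuousLinearMap.orthogonal_ker`,
`Submodule.topologicalClosure_coe`.
-/

noncomputable section

open RCLike

open scoped InnerProductSpace ComplexConjugate NNReal

variable {𝕜 E : Type*} [RCLike 𝕜] [NormedAddCommGroup E] [InnerProductSpace 𝕜 E]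

namespace ContinuousLinearMap

/-! #### Elementary facts about an operator fixing `Ω` -/

/-- (Dot-notation namespace of Mathlib's `ContinuousLinearMap`, as in `SpectralGap.lean`.)
A symmetric bounded operator fixing `Ω` maps `{Ω}ᗮ` into itself:
`⟪Ω, T y⟫ = ⟪T Ω, y⟫ = ⟪Ω, y⟫ = 0` (Glimm–Jaffe 1987, §6.1, Thm 6.1.3: `K = K^*`, `K Ω = Ω`).
[folklore] -/
theorem map_mem_orthogonal_span_of_apply_eq {T : E →L[𝕜] E} {Ω : E}
    (hT : (T : E →ₗ[𝕜] E).IsSymmetric) (hΩ : T Ω = Ω) {y : E} (hy : y ∈ (𝕜 ∙ Ω)ᗮ) :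
    T y ∈ (𝕜 ∙ Ω)ᗮ := by
  rw [Submodule.mem_orthogonal_singleton_iff_inner_right] at hy ⊢
  rw [← hT.apply_clm, hΩ, hy]

/-- (Dot-notation namespace of Mathlib's `ContinuousLinearMap`.) An operator fixing `Ω` fixes
the line `𝕜 ∙ Ω` pointwise. [folklore] -/
theorem apply_eq_self_of_mem_span {T : E →L[𝕜] E} {Ω : E} (hΩ : T Ω = Ω) {p : E}
    (hp : p ∈ 𝕜 ∙ Ω) : T p = p := by
  obtain ⟨c, rfl⟩ := Submodule.mem_span_singleton.mp hp
  rw [map_smul, hΩ]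

/-- (Dot-notation namespace of Mathlib's `ContinuousLinearMap`.) **`T ≤ 1` for a transfer
matrix.** If `T` is symmetric, `T Ω = Ω`, and `re ⟪T y, y⟫ ≤ α ‖y‖²` on `{Ω}ᗮ` with `α ≤ 1`, then
`re ⟪T x, x⟫ ≤ ‖x‖²` for every `x`: writing `x = p + y` with `p ∈ 𝕜Ω`, `y ⊥ Ω`, the cross terms
vanish (`T p = p ⊥ y`, `T y ⊥ p`) and `re ⟪T x, x⟫ = ‖p‖² + re ⟪T y, y⟫ ≤ ‖p‖² + ‖y‖² = ‖x‖²`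
(Glimm–Jaffe 1987, §6.1: the transfer matrix is a contraction, `0 ≤ K ≤ I`). [folklore] -/
theorem re_inner_le_norm_sq_of_orthogonal_bound {T : E →L[𝕜] E} {Ω : E}
    (hT : (T : E →ₗ[𝕜] E).IsSymmetric) (hΩ : T Ω = Ω) {α : ℝ} (hα : α ≤ 1)
    (hK : ∀ y ∈ (𝕜 ∙ Ω)ᗮ, re ⟪T y, y⟫_𝕜 ≤ α * ‖y‖ ^ 2) (x : E) :
    re ⟪T x, x⟫_𝕜 ≤ ‖x‖ ^ 2 := by
  obtain ⟨p, hp, y, hy, rfl⟩ := Submodule.exists_add_mem_mem_orthogonal (K := 𝕜 ∙ Ω) x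
  have hTp : T p = p := apply_eq_self_of_mem_span hΩ hp
  have hTy : T y ∈ (𝕜 ∙ Ω)ᗮ := map_mem_orthogonal_span_of_apply_eq hT hΩ hy
  have hpy : ⟪p, y⟫_𝕜 = 0 := Submodule.inner_right_of_mem_orthogonal hp hy
  have hTyp : ⟪T y, p⟫_𝕜 = 0 := Submodule.inner_left_of_mem_orthogonal hp hTy
  have hxnorm : ‖p + y‖ ^ 2 = ‖p‖ ^ 2 + ‖y‖ ^ 2 := by
    have := norm_add_sq_eq_norm_sq_add_norm_sq_of_inner_eq_zero p y hpy
    simpa only [sq] using this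
  have hcalc : re ⟪T (p + y), p + y⟫_𝕜 = ‖p‖ ^ 2 + re ⟪T y, y⟫_𝕜 := by
    simp only [map_add, hTp, inner_add_left, inner_add_right, hpy, hTyp, add_zero, zero_add,
      inner_self_eq_norm_sq]
  rw [hcalc, hxnorm]
  have h1 := hK y hy
  have h2 : α * ‖y‖ ^ 2 ≤ ‖y‖ ^ 2 := by
    have := mul_le_mul_of_nonneg_right hα (sq_nonneg ‖y‖)
    linarith
  linarith

/-! #### The discharge -/

section Discharge

variable [CompleteSpace E]

/-- **Discharge** of the named fact `ContinuousLinearMap.hasTransferGap_iff_spectrum`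
(spectral characterisation of the transfer-matrix gap; Glimm–Jaffe, *Quantum Physics*, §6.1,
Thm 6.1.3 ff.; Reed–Simon I, Thm VI.8 and §VII.3): `T.HasTransferGap Ω m` iff `T` is
self-adjoint, `Ω ≠ 0`, `0 < m`, `re σ(T) ⊆ [0, e^{-m}] ∪ {1}` and `eigenspace T 1 = 𝕜 ∙ Ω`.

The printed route is the spectral theorem (Reed–Simon I, §VII.3: isolated points of the spectrum of
a self-adjoint operator are eigenvalues, and `inf σ(T)`, `sup σ(T)` bound the quadratic form);
Mathlib has no spectral theorem for bounded self-adjoint operators over `RCLike 𝕜`, so both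
directions use the elementary numerical-range/resolvent lemmas of `SpectralGapProofs.lean`.
(⇒) positivity gives self-adjointness; a fixed vector `x = p + y` (`p ∈ 𝕜Ω`, `y ⊥ Ω`) has
`T y = y`, so `‖y‖² = re ⟪T y, y⟫ ≤ e^{-m} ‖y‖²` forces `y = 0`, i.e. `eigenspace T 1 = 𝕜 ∙ Ω`; for
`μ ∈ σ(T)` with `re μ ∉ [0, e^{-m}] ∪ {1}` we contradict `μ ∈ σ(T)` by inverting `T - μ`:
coercively when `im μ ≠ 0` (Reed–Simon I, proof of Thm VI.8), `re μ < 0` (`T ≥ 0`) or `re μ > 1`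
(`T ≤ 1`, `re_inner_le_norm_sq_of_orthogonal_bound`), and by the lower bound
`min (1 - re μ) (re μ - e^{-m}) ‖x‖ ≤ ‖(T - μ) x‖` on `𝕜Ω ⊕ {Ω}ᗮ` when `e^{-m} < re μ < 1`
(`isUnit_of_isSelfAdjoint_of_forall_le_norm`).
(⇐) real points off `[0, e^{-m}] ∪ {1}` are resolvent points, so `0 ≤ T ≤ 1`
(`re_inner_ge_of_forall_lt_isUnit`, `re_inner_le_of_forall_gt_isUnit`), `T Ω = Ω` from the
eigenspace, and `T' = 1 - T ≥ 0` has `T' - ν` invertible for `0 < ν < 1 - e^{-m}`, whence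
`T' ≥ 1 - e^{-m}` on `range T'` (`gap_le_re_inner_on_range`) and on its closure
`(ker T')ᗮ = (eigenspace T 1)ᗮ = {Ω}ᗮ` (`orthogonal_ker`), i.e. `re ⟪T x, x⟫ ≤ e^{-m} ‖x‖²` there.
[cite: ReedSimonI1980, Thm VI.8 and §VII.3 (Thm VII.10, spectral projections)] -/
theorem hasTransferGap_iff_spectrum_holds :
    hasTransferGap_iff_spectrum (𝕜 := 𝕜) (E := E) := by
  intro T Ω m
  set α : ℝ := Real.exp (-m) with hα_def
  have hα0 : 0 < α := Real.exp_pos _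
  constructor
  · -- (⇒) transfer gap ⇒ spectral data
    rintro ⟨hpos, hΩ0, hTΩ, hm, hgap⟩
    have hα1 : α < 1 := Real.exp_lt_one_iff.mpr (by linarith)
    have hsymm : (T : E →ₗ[𝕜] E).IsSymmetric := hpos.isSymmetric
    have hT : IsSelfAdjoint T := hpos.isSelfAdjoint
    have hform0 : ∀ x, 0 ≤ re ⟪T x, x⟫_𝕜 := hpos.re_inner_nonneg_left
    have hform1 : ∀ x, re ⟪T x, x⟫_𝕜 ≤ ‖x‖ ^ 2 :=
      re_inner_le_norm_sq_of_orthogonal_bound hsymm hTΩ hα1.le hgap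
    have hTK : ∀ y ∈ (𝕜 ∙ Ω)ᗮ, T y ∈ (𝕜 ∙ Ω)ᗮ := fun y hy =>
      map_mem_orthogonal_span_of_apply_eq hsymm hTΩ hy
    refine ⟨hT, hΩ0, hm, ?_, ?_⟩
    · -- the spectrum: `re σ(T) ⊆ [0, α] ∪ {1}`
      rintro _ ⟨μ, hμ, rfl⟩
      by_contra hcon
      simp only [Set.mem_union, Set.mem_Icc, Set.mem_singleton_iff, not_or, not_and_or,
        not_le] at hcon
      obtain ⟨hrange, hne1⟩ := hcon
      refine (mem_spectrum_iff_not_isUnit T μ).mp hμ ?_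
      rcases ne_or_eq (im μ) 0 with him | him
      · -- `im μ ≠ 0`: `|⟪(T - μ) x, x⟫_𝕜| ≥ |im μ| ‖x‖²` (Reed–Simon I, proof of Thm VI.8)
        refine isUnit_of_forall_le_norm_inner_map _ (c := Real.toNNReal |im μ|)
          (Real.toNNReal_pos.mpr (abs_pos.mpr him)) fun x => ?_
        rw [Real.coe_toNNReal _ (abs_nonneg _)]
        have hTim : im ⟪T x, x⟫_𝕜 = 0 := by
          have := hsymm.im_inner_apply_self x
          simpa only [coe_coe] using this
        have hcalc : im ⟪(T - μ • (1 : E →L[𝕜] E)) x, x⟫_𝕜 = im μ * ‖x‖ ^ 2 := by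
          simp only [sub_apply, smul_apply, one_apply_eq_self, inner_sub_left, inner_smul_left,
            map_sub, RCLike.mul_im, RCLike.conj_re, RCLike.conj_im, inner_self_im, mul_zero,
            zero_add, hTim, inner_self_eq_norm_sq]
          ring
        calc ‖x‖ ^ 2 * |im μ| = |im ⟪(T - μ • (1 : E →L[𝕜] E)) x, x⟫_𝕜| := by
              rw [hcalc, abs_mul, abs_of_nonneg (sq_nonneg ‖x‖), mul_comm]
          _ ≤ ‖⟪(T - μ • (1 : E →L[𝕜] E)) x, x⟫_𝕜‖ := RCLike.abs_im_le_norm _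
      · -- `μ` is real
        have hμ_eq : μ = ((re μ : ℝ) : 𝕜) := by
          apply RCLike.ext <;> simp [him]
        rw [hμ_eq]
        rcases hrange with ha | ha
        · -- `re μ < 0`: `T - μ ≥ -μ > 0` is coercive
          refine isUnit_of_forall_le_norm_inner_map _ (c := Real.toNNReal (-re μ))
            (Real.toNNReal_pos.mpr (by linarith)) fun x => ?_
          rw [Real.coe_toNNReal _ (by linarith)]
          have h1 := re_inner_sub_real_smul_one_apply T (re μ) x
          have h2 := hform0 x
          calc ‖x‖ ^ 2 * -re μ ≤ re ⟪(T - ((re μ : ℝ) : 𝕜) • (1 : E →L[𝕜] E)) x, x⟫_𝕜 := by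
                rw [h1]; nlinarith [sq_nonneg ‖x‖]
            _ ≤ ‖⟪(T - ((re μ : ℝ) : 𝕜) • (1 : E →L[𝕜] E)) x, x⟫_𝕜‖ := RCLike.re_le_norm _
        · rcases lt_or_gt_of_ne hne1 with ha1 | ha1
          · -- `α < re μ < 1`: `T - μ` is bounded below by `min (1 - re μ) (re μ - α)`
            set a : ℝ := re μ with ha_def
            set A := T - (a : 𝕜) • (1 : E →L[𝕜] E) with hA_def
            refine isUnit_of_isSelfAdjoint_of_forall_le_norm (hT.sub_real_smul_one a)
              (c := min (1 - a) (a - α)) (lt_min (by linarith) (by linarith)) fun x => ?_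
            obtain ⟨p, hp, y, hy, rfl⟩ := Submodule.exists_add_mem_mem_orthogonal (K := 𝕜 ∙ Ω) x
            have hApply : ∀ z, A z = T z - (a : 𝕜) • z := fun z => by
              simp only [hA_def, sub_apply, smul_apply, one_apply_eq_self]
            have hAp : A p = ((1 - a : ℝ) : 𝕜) • p := by
              rw [hApply, apply_eq_self_of_mem_span hTΩ hp, RCLike.ofReal_sub, RCLike.ofReal_one,
                sub_smul, one_smul]
            have hAp_mem : A p ∈ 𝕜 ∙ Ω := by
              rw [hAp]
              exact Submodule.smul_mem _ _ hp
            have hAy_mem : A y ∈ (𝕜 ∙ Ω)ᗮ := by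
              rw [hApply]
              exact Submodule.sub_mem _ (hTK y hy) (Submodule.smul_mem _ _ hy)
            have hxnorm : ‖p + y‖ ^ 2 = ‖p‖ ^ 2 + ‖y‖ ^ 2 := by
              have := norm_add_sq_eq_norm_sq_add_norm_sq_of_inner_eq_zero p y
                (Submodule.inner_right_of_mem_orthogonal hp hy)
              simpa only [sq] using this
            have hAnorm : ‖A (p + y)‖ ^ 2 = ‖A p‖ ^ 2 + ‖A y‖ ^ 2 := by
              rw [map_add]
              have := norm_add_sq_eq_norm_sq_add_norm_sq_of_inner_eq_zero (A p) (A y)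
                (Submodule.inner_right_of_mem_orthogonal hAp_mem hAy_mem)
              simpa only [sq] using this
            have hAp_norm : ‖A p‖ = (1 - a) * ‖p‖ := by
              rw [hAp, norm_smul, RCLike.norm_ofReal, abs_of_pos (by linarith)]
            have hAy_norm : (a - α) * ‖y‖ ≤ ‖A y‖ := by
              have h1 : (a - α) * ‖y‖ ^ 2 ≤ -re ⟪A y, y⟫_𝕜 := by
                rw [hA_def, re_inner_sub_real_smul_one_apply]
                have := hgap y hy
                linarith
              have h2 : -re ⟪A y, y⟫_𝕜 ≤ ‖A y‖ * ‖y‖ :=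
                (neg_le_abs _).trans ((RCLike.abs_re_le_norm _).trans (norm_inner_le_norm _ _))
              by_cases hy0 : y = 0
              · simp [hy0]
              · have hypos : 0 < ‖y‖ := norm_pos_iff.mpr hy0
                refine le_of_mul_le_mul_right ?_ hypos
                calc (a - α) * ‖y‖ * ‖y‖ = (a - α) * ‖y‖ ^ 2 := by ring
                  _ ≤ ‖A y‖ * ‖y‖ := h1.trans h2
            have hc0 : 0 ≤ min (1 - a) (a - α) := le_min (by linarith) (by linarith)
            have hsq : (min (1 - a) (a - α) * ‖p + y‖) ^ 2 ≤ ‖A (p + y)‖ ^ 2 := by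
              rw [mul_pow, hxnorm, hAnorm, hAp_norm, mul_add]
              gcongr ?_ + ?_
              · rw [mul_pow]
                exact mul_le_mul_of_nonneg_right
                  (pow_le_pow_left₀ hc0 (min_le_left _ _) 2) (sq_nonneg _)
              · calc min (1 - a) (a - α) ^ 2 * ‖y‖ ^ 2 = (min (1 - a) (a - α) * ‖y‖) ^ 2 := by
                      ring
                  _ ≤ ((a - α) * ‖y‖) ^ 2 :=
                      pow_le_pow_left₀ (mul_nonneg hc0 (norm_nonneg _))
                        (mul_le_mul_of_nonneg_right (min_le_right _ _) (norm_nonneg _)) 2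
                  _ ≤ ‖A y‖ ^ 2 :=
                      pow_le_pow_left₀ (mul_nonneg (by linarith) (norm_nonneg _)) hAy_norm 2
            exact (pow_le_pow_iff_left₀ (mul_nonneg hc0 (norm_nonneg _)) (norm_nonneg _)
              two_ne_zero).mp hsq
          · -- `1 < re μ`: `μ - T ≥ μ - 1 > 0` is coercive
            refine isUnit_of_forall_le_norm_inner_map _ (c := Real.toNNReal (re μ - 1))
              (Real.toNNReal_pos.mpr (by linarith)) fun x => ?_
            rw [Real.coe_toNNReal _ (by linarith)]
            have h1 := re_inner_sub_real_smul_one_apply T (re μ) x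
            have h2 := hform1 x
            calc ‖x‖ ^ 2 * (re μ - 1)
                ≤ -re ⟪(T - ((re μ : ℝ) : 𝕜) • (1 : E →L[𝕜] E)) x, x⟫_𝕜 := by
                  rw [h1]; nlinarith [sq_nonneg ‖x‖]
              _ ≤ |re ⟪(T - ((re μ : ℝ) : 𝕜) • (1 : E →L[𝕜] E)) x, x⟫_𝕜| := neg_le_abs _
              _ ≤ ‖⟪(T - ((re μ : ℝ) : 𝕜) • (1 : E →L[𝕜] E)) x, x⟫_𝕜‖ := RCLike.abs_re_le_norm _
    · -- the eigenvalue `1` is simple with eigenvector `Ω`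
      refine le_antisymm ?_ ?_
      · intro x hx
        rw [Module.End.mem_eigenspace_iff, one_smul, coe_coe] at hx
        obtain ⟨p, hp, y, hy, rfl⟩ := Submodule.exists_add_mem_mem_orthogonal (K := 𝕜 ∙ Ω) x
        have hTy : T y = y := by
          have h := hx
          rw [map_add, apply_eq_self_of_mem_span hTΩ hp] at h
          exact add_left_cancel h
        have h1 := hgap y hy
        rw [hTy, inner_self_eq_norm_sq] at h1
        have hy0 : y = 0 := by
          have h2 : (1 - α) * ‖y‖ ^ 2 ≤ 0 := by linarith
          have h3 : ‖y‖ ^ 2 ≤ 0 := nonpos_of_mul_nonpos_right h2 (by linarith)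
          have h4 : ‖y‖ ^ 2 = 0 := le_antisymm h3 (sq_nonneg _)
          exact norm_eq_zero.mp ((pow_eq_zero_iff two_ne_zero).mp h4)
        rw [hy0, add_zero]
        exact hp
      · rw [Submodule.span_le, Set.singleton_subset_iff, SetLike.mem_coe,
          Module.End.mem_eigenspace_iff, one_smul, coe_coe]
        exact hTΩ
  · -- (⇐) spectral data ⇒ transfer gap
    rintro ⟨hT, hΩ0, hm, hspec, heig⟩
    have hα1 : α < 1 := Real.exp_lt_one_iff.mpr (by linarith)
    have hsymm : (T : E →ₗ[𝕜] E).IsSymmetric := hT.isSymmetric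
    have hTΩ : T Ω = Ω := by
      have h : Ω ∈ Module.End.eigenspace (T : E →ₗ[𝕜] E) 1 := by
        rw [heig]
        exact Submodule.mem_span_singleton_self Ω
      rw [Module.End.mem_eigenspace_iff, one_smul, coe_coe] at h
      exact h
    -- real points off `[0, α] ∪ {1}` are in the resolvent set
    have hunit : ∀ ν : ℝ, (ν < 0 ∨ α < ν) → ν ≠ 1 →
        IsUnit (T - (ν : 𝕜) • (1 : E →L[𝕜] E)) := by
      intro ν hν hν1
      by_contra hnu
      have hmem : (ν : 𝕜) ∈ spectrum 𝕜 T := (mem_spectrum_iff_not_isUnit T ν).mpr hnu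
      have := hspec (Set.mem_image_of_mem re hmem)
      rw [RCLike.ofReal_re] at this
      rcases this with h | h
      · obtain ⟨h0, h1⟩ := h
        rcases hν with hν | hν <;> linarith
      · exact hν1 (Set.mem_singleton_iff.mp h)
    -- `0 ≤ T ≤ 1`
    have hform0 : ∀ x, 0 ≤ re ⟪T x, x⟫_𝕜 := fun x => by
      have := re_inner_ge_of_forall_lt_isUnit hT 0
        (fun μ hμ => hunit μ (Or.inl hμ) (by intro h; linarith)) x
      simpa using this
    have hform1 : ∀ x, re ⟪T x, x⟫_𝕜 ≤ 1 * ‖x‖ ^ 2 := fun x =>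
      re_inner_le_of_forall_gt_isUnit hT 1
        (fun μ hμ => hunit μ (Or.inr (by linarith)) (by intro h; linarith)) x
    -- `T' := 1 - T ≥ 0`
    set T' : E →L[𝕜] E := 1 - T with hT'_def
    have hT'apply : ∀ x, T' x = x - T x := fun x => by
      simp only [hT'_def, sub_apply, one_apply_eq_self]
    have hT'symm : (T' : E →ₗ[𝕜] E).IsSymmetric := by
      intro x y
      simp only [coe_coe, hT'apply, inner_sub_left, inner_sub_right, hsymm.apply_clm x y]
    have hT'sa : IsSelfAdjoint T' := hT'symm.isSelfAdjoint
    have hT're : ∀ x, re ⟪T' x, x⟫_𝕜 = ‖x‖ ^ 2 - re ⟪T x, x⟫_𝕜 := fun x => by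
      rw [hT'apply, inner_sub_left, map_sub, inner_self_eq_norm_sq]
    have hT'pos : T'.IsPositive :=
      ⟨hT'symm, fun x => by
        rw [reApplyInnerSelf_apply, hT're]
        have := hform1 x
        linarith⟩
    -- `T' - ν` is invertible for `0 < ν < 1 - α`
    have hβ : 0 < 1 - α := by linarith
    have hunit' : ∀ ν : ℝ, 0 < ν → ν < 1 - α →
        IsUnit (T' - (ν : 𝕜) • (1 : E →L[𝕜] E)) := by
      intro ν hν0 hνβ
      have hu := hunit (1 - ν) (Or.inr (by linarith)) (by intro h; linarith)
      have heq : T' - (ν : 𝕜) • (1 : E →L[𝕜] E) =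
          -(T - ((1 - ν : ℝ) : 𝕜) • (1 : E →L[𝕜] E)) := by
        rw [hT'_def, RCLike.ofReal_sub, RCLike.ofReal_one, sub_smul, one_smul]
        abel
      rw [heq]
      exact hu.neg
    -- `T' ≥ 1 - α` on `range T'`
    have hrange : ∀ x, (1 - α) * ‖T' x‖ ^ 2 ≤ re ⟪T' (T' x), T' x⟫_𝕜 :=
      gap_le_re_inner_on_range hT'pos hβ hunit'
    -- `ker T' = eigenspace T 1 = 𝕜 ∙ Ω`
    have hker : LinearMap.ker (T' : E →ₗ[𝕜] E) = 𝕜 ∙ Ω := by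
      rw [← heig]
      ext x
      rw [LinearMap.mem_ker, Module.End.mem_eigenspace_iff, one_smul, coe_coe, coe_coe, hT'apply,
        sub_eq_zero, eq_comm]
    -- hence `T' ≥ 1 - α` on the closure `(ker T')ᗮ = {Ω}ᗮ` of `range T'`
    have hK : ∀ y ∈ (𝕜 ∙ Ω)ᗮ, (1 - α) * ‖y‖ ^ 2 ≤ re ⟪T' y, y⟫_𝕜 := by
      have hcl : ((𝕜 ∙ Ω)ᗮ : Set E) ⊆
          closure (LinearMap.range (T' : E →ₗ[𝕜] E) : Set E) := by
        have h1 : (𝕜 ∙ Ω)ᗮ = (LinearMap.range (T' : E →ₗ[𝕜] E)).topologicalClosure := by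
          rw [← hker]
          have := orthogonal_ker T'
          rw [hT'sa.adjoint_eq] at this
          exact this
        rw [h1, Submodule.topologicalClosure_coe]
      have hclosed : IsClosed {y : E | (1 - α) * ‖y‖ ^ 2 ≤ re ⟪T' y, y⟫_𝕜} :=
        isClosed_le (continuous_const.mul (continuous_norm.pow 2))
          (continuous_re.comp (T'.continuous.inner continuous_id))
      intro y hy
      refine (hclosed.closure_subset_iff.mpr ?_) (hcl hy)
      rintro _ ⟨x, rfl⟩
      exact hrange x
    -- assemble the transfer gap
    refine ⟨⟨hsymm, fun x => ?_⟩, hΩ0, hTΩ, hm, fun x hx => ?_⟩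
    · rw [reApplyInnerSelf_apply]
      exact hform0 x
    · have := hK x hx
      rw [hT're] at this
      linarith

end Discharge

end ContinuousLinearMap
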